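import Summits.HodgeConjecture.CorCM.Census.CentralSquaresStrictCover

/-!
# The square-central class, XIII: CHOSEN strict lowering covers (constrained covers)

COR-CM (cell `pub-hodgecm2`), count-neutral kernel combinatorics by the binder seat b09 (gen 45; lane SQUARE-CENTRAL CLASS, part XIII), on part I
(`exists_strict_lowering_cover`, `strict_rt`) and part 0 (`isLeast_card_gfaces_generate_of_residual_closure_par`), BY NAME.  Theorems only; no `decide`,
no certificate, no named fact, no `sorry`.  HONEST FRAMING: `HC_CM` is NOT proved, here or anywhere in the tree; nothing here is a period or a headline.

Part Iʼs strict lowering cover is built from an ARBITRARY admissible choice of one lowering face per far block representative (strict wherever a strict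
face exists).  For the rows beyond the four-type law with `m ≥ 3` the choice matters: at `m = 2` (the degree-16 rows `D₄ × ℤ/2`, `G(16,3)`) the level-4
blocks carry NO strict face and an all-bad lowering cover leaves the near relation lattice at rank `8/10` (numerics, `lean-g45/py/m2adv.py`), while the
cover taking at ONE `Q`-stable pair type `{T | a, σa}` the face with places `T` closes (`10/10`, Smith `[2,2]`, for every strict choice below; `m2pair.py`).
This file exports the cover construction with the choice as a PARAMETER:
* `exists_chosen_strict_lowering_cover τ`: for every admissible choice `τ : Block c → G × G × G` (lowering at every far block representative, strict
  wherever a strict triple exists there) a parity-independent strict lowering cover `S` CONTAINING the chosen faces `gface Bk.out (τ Bk).2.1 (τ Bk).2.2`;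
* `isLeast_card_gfaces_generate_of_chosen_cover_closure`: **μ = φ₂** as soon as, for ONE admissible choice `τ`, every strict lowering cover containing
  the chosen faces `2^k`-closes the residual Hodge vectors (the constrained form of part Iʼs strict cover-closure law).

## References
* [Pohlmann1968] H. Pohlmann, Algebraic cycles on abelian varieties of complex multiplication type, Ann. of Math. 88 (1968), Thm 1.
* [Milne1999] J. S. Milne, Lefschetz motives and the Tate conjecture, Compositio Math. 117 (1999), Prop. 2.1, p. 54.
-/

namespace Summit.HodgeConjecture.CorCM.Census.CoverClosure

open Finset
open Summit.HodgeConjecture.CorCM.Prior.AllgGroup.RfwfAllgGroup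
open Summit.HodgeConjecture.CorCM.Census.BlockParity
open Summit.HodgeConjecture.CorCM.Census.Coinvariant
open Summit.HodgeConjecture.CorCM.Census.TwistGeneration
open Summit.HodgeConjecture.CorCM.Census.BaseBlock
open Summit.HodgeConjecture.CorCM.Census.Splitting

noncomputable section

variable {G : Type*} [Group G] [Fintype G] [DecidableEq G] (c : G) (T₀ : CMF G c)

/-! ## §1 The cover built from an admissible choice -/

/-- **THE CHOSEN STRICT LOWERING COVER.**  Given, at every block representative `Bk.out` of potential `≥ 2`, a lowering triple `τ Bk = (Q, s, s')`
(nearest base change `T₀·Q⁻¹`, two distinct deviation places) that is strict wherever a strict triple exists at `Bk.out`, the faces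
`gface Bk.out s s'` form a parity-independent cover `S`, one face per far block, lowering (and strict where possible) through EVERY far type by
translation, with the descent to the residual types — and `S` contains the chosen faces. [folklore] -/
theorem exists_chosen_strict_lowering_cover (hc2 : c * c = 1) (τ : Block c → G × G × G)
    (hτlow : ∀ Bk : Block c, 2 ≤ bpot c T₀ Bk.out →
      bpot c T₀ Bk.out = ddist (rt c (τ Bk).1 T₀) Bk.out ∧
        (τ Bk).2.1 ∈ (rt c (τ Bk).1 T₀).1 \ Bk.out.1 ∧ (τ Bk).2.2 ∈ (rt c (τ Bk).1 T₀).1 \ Bk.out.1 ∧ (τ Bk).2.1 ≠ (τ Bk).2.2)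
    (hτstr : ∀ Bk : Block c, (∃ Q₁ t t' : G, bpot c T₀ Bk.out = ddist (rt c Q₁ T₀) Bk.out ∧
        t ∈ (rt c Q₁ T₀).1 \ Bk.out.1 ∧ t' ∈ (rt c Q₁ T₀).1 \ Bk.out.1 ∧ t ≠ t' ∧
        (∀ Q' : G, ddist (rt c Q' T₀) (oflipCM c hc2 t Bk.out) = bpot c T₀ (oflipCM c hc2 t Bk.out) → rt c Q' T₀ = rt c Q₁ T₀) ∧
        (∀ Q' : G, ddist (rt c Q' T₀) (oflipCM c hc2 t' Bk.out) = bpot c T₀ (oflipCM c hc2 t' Bk.out) → rt c Q' T₀ = rt c Q₁ T₀) ∧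
        (∀ Q' : G, ddist (rt c Q' T₀) (oflipCM c hc2 t (oflipCM c hc2 t' Bk.out)) = bpot c T₀ (oflipCM c hc2 t (oflipCM c hc2 t' Bk.out)) →
          rt c Q' T₀ = rt c Q₁ T₀)) →
      bpot c T₀ Bk.out = ddist (rt c (τ Bk).1 T₀) Bk.out ∧
        (τ Bk).2.1 ∈ (rt c (τ Bk).1 T₀).1 \ Bk.out.1 ∧ (τ Bk).2.2 ∈ (rt c (τ Bk).1 T₀).1 \ Bk.out.1 ∧ (τ Bk).2.1 ≠ (τ Bk).2.2 ∧
        (∀ Q' : G, ddist (rt c Q' T₀) (oflipCM c hc2 (τ Bk).2.1 Bk.out) = bpot c T₀ (oflipCM c hc2 (τ Bk).2.1 Bk.out) →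
          rt c Q' T₀ = rt c (τ Bk).1 T₀) ∧
        (∀ Q' : G, ddist (rt c Q' T₀) (oflipCM c hc2 (τ Bk).2.2 Bk.out) = bpot c T₀ (oflipCM c hc2 (τ Bk).2.2 Bk.out) →
          rt c Q' T₀ = rt c (τ Bk).1 T₀) ∧
        (∀ Q' : G, ddist (rt c Q' T₀) (oflipCM c hc2 (τ Bk).2.1 (oflipCM c hc2 (τ Bk).2.2 Bk.out)) =
            bpot c T₀ (oflipCM c hc2 (τ Bk).2.1 (oflipCM c hc2 (τ Bk).2.2 Bk.out)) → rt c Q' T₀ = rt c (τ Bk).1 T₀)) :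
    ∃ S : Finset (CMF G c →₀ ℤ), (↑S ⊆ gfaceSet G c hc2) ∧
      (∀ Bk : Block c, 2 ≤ bpot c T₀ Bk.out → gface c hc2 Bk.out (τ Bk).2.1 (τ Bk).2.2 ∈ S) ∧
      S.card = (univ.filter fun Bk : Block c => 2 ≤ bpot c T₀ Bk.out).card ∧
      LinearIndepOn (ZMod 2) (fun f : CMF G c →₀ ℤ => par c f) ↑S ∧
      (∀ Ψ : CMF G c, 2 ≤ bpot c T₀ Ψ → ∃ Q s s' : G, bpot c T₀ Ψ = ddist (rt c Q T₀) Ψ ∧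
        s ∈ (rt c Q T₀).1 \ Ψ.1 ∧ s' ∈ (rt c Q T₀).1 \ Ψ.1 ∧ s ≠ s' ∧
        gface c hc2 Ψ s s' ∈ Submodule.span ℤ (translates c S) ∧
        ((∃ Q₁ t t' : G, bpot c T₀ Ψ = ddist (rt c Q₁ T₀) Ψ ∧ t ∈ (rt c Q₁ T₀).1 \ Ψ.1 ∧ t' ∈ (rt c Q₁ T₀).1 \ Ψ.1 ∧ t ≠ t' ∧
            (∀ Q' : G, ddist (rt c Q' T₀) (oflipCM c hc2 t Ψ) = bpot c T₀ (oflipCM c hc2 t Ψ) → rt c Q' T₀ = rt c Q₁ T₀) ∧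
            (∀ Q' : G, ddist (rt c Q' T₀) (oflipCM c hc2 t' Ψ) = bpot c T₀ (oflipCM c hc2 t' Ψ) → rt c Q' T₀ = rt c Q₁ T₀) ∧
            (∀ Q' : G, ddist (rt c Q' T₀) (oflipCM c hc2 t (oflipCM c hc2 t' Ψ)) = bpot c T₀ (oflipCM c hc2 t (oflipCM c hc2 t' Ψ)) →
              rt c Q' T₀ = rt c Q₁ T₀)) →
          (∀ Q' : G, ddist (rt c Q' T₀) (oflipCM c hc2 s Ψ) = bpot c T₀ (oflipCM c hc2 s Ψ) → rt c Q' T₀ = rt c Q T₀) ∧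
          (∀ Q' : G, ddist (rt c Q' T₀) (oflipCM c hc2 s' Ψ) = bpot c T₀ (oflipCM c hc2 s' Ψ) → rt c Q' T₀ = rt c Q T₀) ∧
          (∀ Q' : G, ddist (rt c Q' T₀) (oflipCM c hc2 s (oflipCM c hc2 s' Ψ)) = bpot c T₀ (oflipCM c hc2 s (oflipCM c hc2 s' Ψ)) →
            rt c Q' T₀ = rt c Q T₀))) ∧
      ∀ L : Submodule ℤ (CMF G c →₀ ℤ), Submodule.span ℤ (translates c S) ≤ L →
        ∀ y : CMF G c →₀ ℤ, ∃ y' : CMF G c →₀ ℤ, y - y' ∈ L ∧ ∀ Ψ ∈ y'.support, bpot c T₀ Ψ ≤ 1 := by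
  classical
  -- strictness of a triple `(Q, t, t')` at a type `X`, as a predicate (local abbreviation inside the proof)
  let Str : CMF G c → G × G × G → Prop := fun X τ =>
    bpot c T₀ X = ddist (rt c τ.1 T₀) X ∧ τ.2.1 ∈ (rt c τ.1 T₀).1 \ X.1 ∧ τ.2.2 ∈ (rt c τ.1 T₀).1 \ X.1 ∧ τ.2.1 ≠ τ.2.2 ∧
      (∀ Q' : G, ddist (rt c Q' T₀) (oflipCM c hc2 τ.2.1 X) = bpot c T₀ (oflipCM c hc2 τ.2.1 X) → rt c Q' T₀ = rt c τ.1 T₀) ∧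
      (∀ Q' : G, ddist (rt c Q' T₀) (oflipCM c hc2 τ.2.2 X) = bpot c T₀ (oflipCM c hc2 τ.2.2 X) → rt c Q' T₀ = rt c τ.1 T₀) ∧
      (∀ Q' : G, ddist (rt c Q' T₀) (oflipCM c hc2 τ.2.1 (oflipCM c hc2 τ.2.2 X)) = bpot c T₀ (oflipCM c hc2 τ.2.1 (oflipCM c hc2 τ.2.2 X)) →
        rt c Q' T₀ = rt c τ.1 T₀)
  have hStr_rt : ∀ (X : CMF G c) (τ : G × G × G) (Q : G), Str X τ → Str (rt c Q X) (Q * τ.1, τ.2.1 * Q⁻¹, τ.2.2 * Q⁻¹) := by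
    rintro X ⟨R, t, t'⟩ Q ⟨h1, ht, ht', htt', hu1, hu2, hu3⟩
    exact strict_rt c T₀ hc2 Q h1 ht ht' htt' hu1 hu2 hu3
  -- the given choice is strict wherever a strict triple exists (as a `Str` statement)
  have hτstr' : ∀ Bk : Block c, (∃ τ₁ : G × G × G, Str Bk.out τ₁) → Str Bk.out (τ Bk) := by
    rintro Bk ⟨⟨Q₁, t, t'⟩, h1, ht, ht', htt', hu1, hu2, hu3⟩
    exact hτstr Bk ⟨Q₁, t, t', h1, ht, ht', htt', hu1, hu2, hu3⟩
  set NI : Finset (Block c) := univ.filter fun Bk : Block c => 2 ≤ bpot c T₀ Bk.out with hNI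
  set face : Block c → (CMF G c →₀ ℤ) := fun Bk => gface c hc2 Bk.out (τ Bk).2.1 (τ Bk).2.2 with hfaceDef
  set S : Finset (CMF G c →₀ ℤ) := NI.image face with hS
  have hself : ∀ Bk ∈ NI, par c (face Bk) Bk = 1 := by
    intro Bk hBk
    obtain ⟨h1, h3, h4, h5⟩ := hτlow Bk (mem_filter.mp hBk).2
    have h := par_cover_self c T₀ hc2 h1 h3 h4 h5
    rwa [blk_out] at h
  have hother : ∀ Bk ∈ NI, ∀ B : Block c, B ≠ Bk → bpot c T₀ Bk.out ≤ bpot c T₀ B.out → par c (face Bk) B = 0 := by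
    intro Bk hBk B hB hle
    obtain ⟨h1, h3, h4, h5⟩ := hτlow Bk (mem_filter.mp hBk).2
    exact par_cover_other c T₀ hc2 h1 h3 h4 h5 (by rw [blk_out]; exact hB) hle
  have hinj : Set.InjOn face ↑NI := by
    intro B₁ hB₁ B₂ hB₂ heq
    by_contra hne
    rcases le_total (bpot c T₀ B₁.out) (bpot c T₀ B₂.out) with hle | hle
    · have h0 := hother B₁ hB₁ B₂ (Ne.symm hne) hle
      rw [heq, hself B₂ hB₂] at h0
      exact one_ne_zero h0
    · have h0 := hother B₂ hB₂ B₁ hne hle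
      rw [← heq, hself B₁ hB₁] at h0
      exact one_ne_zero h0
  have hSsub : (↑S : Set (CMF G c →₀ ℤ)) ⊆ gfaceSet G c hc2 := by
    intro y hy
    obtain ⟨Bk, hBk, rfl⟩ := mem_image.mp (mem_coe.mp hy)
    obtain ⟨-, h3, h4, h5⟩ := hτlow Bk (mem_filter.mp hBk).2
    exact ⟨Bk.out, _, _, not_mem_orb_of_mem (mem_sdiff.mp h3).1 (mem_sdiff.mp h4).1 h5, rfl⟩
  -- the lowering property with strictness transfer
  have hlow : ∀ Ψ : CMF G c, 2 ≤ bpot c T₀ Ψ → ∃ Q s s' : G, bpot c T₀ Ψ = ddist (rt c Q T₀) Ψ ∧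
      s ∈ (rt c Q T₀).1 \ Ψ.1 ∧ s' ∈ (rt c Q T₀).1 \ Ψ.1 ∧ s ≠ s' ∧
      gface c hc2 Ψ s s' ∈ Submodule.span ℤ (translates c S) ∧
      ((∃ τ₁ : G × G × G, Str Ψ τ₁) → Str Ψ (Q, s, s')) := by
    intro Ψ hΨ2
    obtain ⟨Q, hQ⟩ := exists_rt_eq_of_blk_eq c (Quotient.out_eq (blk c Ψ) : blk c (blk c Ψ).out = blk c Ψ)
    have hBNI : blk c Ψ ∈ NI := mem_filter.mpr ⟨mem_univ _, by rw [bpot_out]; exact hΨ2⟩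
    obtain ⟨h1, h3, h4, h5⟩ := hτlow (blk c Ψ) (mem_filter.mp hBNI).2
    set R := (τ (blk c Ψ)).1 with hR
    set t := (τ (blk c Ψ)).2.1 with ht
    set t' := (τ (blk c Ψ)).2.2 with ht'
    refine ⟨Q * R, t * Q⁻¹, t' * Q⁻¹, ?_, ?_, ?_, fun h => h5 (mul_right_cancel h), ?_, fun hex => ?_⟩
    · rw [← hQ, bpot_rt, rt_mul, ddist_rt]; exact h1
    · rw [rt_mul, ← hQ, mem_sdiff_rt_iff, inv_mul_cancel_right]; exact h3
    · rw [rt_mul, ← hQ, mem_sdiff_rt_iff, inv_mul_cancel_right]; exact h4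
    · have e : gface c hc2 Ψ (t * Q⁻¹) (t' * Q⁻¹) = Finsupp.mapDomain (rt c Q) (face (blk c Ψ)) := by
        rw [mapDomain_rt_gface, hQ]
      rw [e]
      exact Submodule.subset_span ⟨Q, _, mem_image_of_mem _ hBNI, rfl⟩
    · -- a strict triple at `Ψ` transports to one at the block representative, so `τ` is strict there, and transports back
      obtain ⟨τ₁, hτ₁⟩ := hex
      have hrep : Str (blk c Ψ).out (τ (blk c Ψ)) := by
        refine hτstr' (blk c Ψ) ⟨(Q⁻¹ * τ₁.1, τ₁.2.1 * Q⁻¹⁻¹, τ₁.2.2 * Q⁻¹⁻¹), ?_⟩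
        have h := hStr_rt Ψ τ₁ Q⁻¹ hτ₁
        rwa [← hQ, rt_inv_rt] at h
      have hback := hStr_rt (blk c Ψ).out (τ (blk c Ψ)) Q hrep
      rw [hQ] at hback
      exact hback
  refine ⟨S, hSsub, fun Bk hBk => mem_image_of_mem _ (mem_filter.mpr ⟨mem_univ _, hBk⟩), card_image_of_injOn hinj, ?_,
    fun Ψ hΨ => ?_, fun L hL y => ?_⟩
  · -- parity independence by the pivot criterion (pivot = own block, rank = potential)
    set p : (CMF G c →₀ ℤ) → Block c := fun f => if h : ∃ Bk ∈ NI, face Bk = f then h.choose else blk c T₀ with hp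
    have hpf : ∀ Bk ∈ NI, p (face Bk) = Bk := by
      intro Bk hBk
      have h : ∃ B ∈ NI, face B = face Bk := ⟨Bk, hBk, rfl⟩
      rw [hp]; simp only [dif_pos h]
      exact hinj h.choose_spec.1 hBk h.choose_spec.2
    rw [LinearIndepOn, linearIndependent_iff']
    intro t g hsum i₁ hi₁
    by_contra hgi₁
    obtain ⟨i₀, hi₀, hmax⟩ := Finset.exists_max_image (t.filter fun i => g i ≠ 0) (fun i => bpot c T₀ (p i.1).out)
      ⟨i₁, mem_filter.mpr ⟨hi₁, hgi₁⟩⟩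
    obtain ⟨hi₀t, hgi₀⟩ := mem_filter.mp hi₀
    obtain ⟨B₀, hB₀, hfB₀⟩ := mem_image.mp i₀.2
    have hp₀ : p i₀.1 = B₀ := by rw [← hfB₀]; exact hpf B₀ hB₀
    have heval := congrFun hsum B₀
    rw [Finset.sum_apply, Pi.zero_apply, Finset.sum_eq_single_of_mem i₀ hi₀t] at heval
    · rw [Pi.smul_apply, smul_eq_mul, ← hfB₀, hself B₀ hB₀, mul_one] at heval
      exact hgi₀ heval
    · intro j hjt hji
      rw [Pi.smul_apply, smul_eq_mul]
      by_cases hgj : g j = 0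
      · rw [hgj, zero_mul]
      · obtain ⟨Bj, hBj, hfBj⟩ := mem_image.mp j.2
        have hpj : p j.1 = Bj := by rw [← hfBj]; exact hpf Bj hBj
        have hlj : bpot c T₀ Bj.out ≤ bpot c T₀ B₀.out := by
          have h := hmax j (mem_filter.mpr ⟨hjt, hgj⟩)
          rwa [hpj, hp₀] at h
        have hne : B₀ ≠ Bj := fun e => hji (Subtype.ext (by rw [← hfBj, ← hfB₀, e]))
        rw [← hfBj, hother Bj hBj B₀ hne hlj, mul_zero]
  · -- the exported lowering + strictness property
    obtain ⟨Q, s, s', hQ, hs, hs', hss', hmem, hstr⟩ := hlow Ψ hΨ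
    refine ⟨Q, s, s', hQ, hs, hs', hss', hmem, fun hex => ?_⟩
    obtain ⟨Q₁, t, t', h1, ht, ht', htt', hu1, hu2, hu3⟩ := hex
    obtain ⟨-, -, -, -, k1, k2, k3⟩ := hstr ⟨(Q₁, t, t'), h1, ht, ht', htt', hu1, hu2, hu3⟩
    exact ⟨k1, k2, k3⟩
  · -- descent on the potential, fed by the lowering property
    refine descent c (bpot c T₀) (fun Ψ => bpot c T₀ Ψ ≤ 1) hc2 L (fun Ψ hΨ => ?_) y
    obtain ⟨Q, s, s', hQ, hs, hs', hss', hmem, -⟩ := hlow Ψ (by omega)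
    exact ⟨s, s', hL hmem, bpot_corners_lt c T₀ hc2 hQ hs hs' hss'⟩


/-! ## §2 The constrained cover-closure law -/

/-- **THE CHOSEN COVER-CLOSURE LAW.**  `G` a `2`-group, `c` a central involution `≠ 1`, `T₀` any base type, `τ` an admissible choice (lowering at every
far block representative, strict wherever possible): if every strict lowering cover `S` CONTAINING the chosen faces puts every residual Hodge vector into
`ℤ⟨pairs⟩ + ℤ⟨base changes of S⟩` up to `2^k`, then **`μ(G,c) = φ₂(G,c)`**. [folklore] -/
theorem isLeast_card_gfaces_generate_of_chosen_cover_closure (hG : IsPGroup 2 G) (hc2 : c * c = 1) (hc1 : c ≠ 1)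
    (hcen : ∀ x : G, x * c = c * x) (k : ℕ) (τ : Block c → G × G × G)
    (hτlow : ∀ Bk : Block c, 2 ≤ bpot c T₀ Bk.out →
      bpot c T₀ Bk.out = ddist (rt c (τ Bk).1 T₀) Bk.out ∧
        (τ Bk).2.1 ∈ (rt c (τ Bk).1 T₀).1 \ Bk.out.1 ∧ (τ Bk).2.2 ∈ (rt c (τ Bk).1 T₀).1 \ Bk.out.1 ∧ (τ Bk).2.1 ≠ (τ Bk).2.2)
    (hτstr : ∀ Bk : Block c, (∃ Q₁ t t' : G, bpot c T₀ Bk.out = ddist (rt c Q₁ T₀) Bk.out ∧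
        t ∈ (rt c Q₁ T₀).1 \ Bk.out.1 ∧ t' ∈ (rt c Q₁ T₀).1 \ Bk.out.1 ∧ t ≠ t' ∧
        (∀ Q' : G, ddist (rt c Q' T₀) (oflipCM c hc2 t Bk.out) = bpot c T₀ (oflipCM c hc2 t Bk.out) → rt c Q' T₀ = rt c Q₁ T₀) ∧
        (∀ Q' : G, ddist (rt c Q' T₀) (oflipCM c hc2 t' Bk.out) = bpot c T₀ (oflipCM c hc2 t' Bk.out) → rt c Q' T₀ = rt c Q₁ T₀) ∧
        (∀ Q' : G, ddist (rt c Q' T₀) (oflipCM c hc2 t (oflipCM c hc2 t' Bk.out)) = bpot c T₀ (oflipCM c hc2 t (oflipCM c hc2 t' Bk.out)) →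
          rt c Q' T₀ = rt c Q₁ T₀)) →
      bpot c T₀ Bk.out = ddist (rt c (τ Bk).1 T₀) Bk.out ∧
        (τ Bk).2.1 ∈ (rt c (τ Bk).1 T₀).1 \ Bk.out.1 ∧ (τ Bk).2.2 ∈ (rt c (τ Bk).1 T₀).1 \ Bk.out.1 ∧ (τ Bk).2.1 ≠ (τ Bk).2.2 ∧
        (∀ Q' : G, ddist (rt c Q' T₀) (oflipCM c hc2 (τ Bk).2.1 Bk.out) = bpot c T₀ (oflipCM c hc2 (τ Bk).2.1 Bk.out) →
          rt c Q' T₀ = rt c (τ Bk).1 T₀) ∧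
        (∀ Q' : G, ddist (rt c Q' T₀) (oflipCM c hc2 (τ Bk).2.2 Bk.out) = bpot c T₀ (oflipCM c hc2 (τ Bk).2.2 Bk.out) →
          rt c Q' T₀ = rt c (τ Bk).1 T₀) ∧
        (∀ Q' : G, ddist (rt c Q' T₀) (oflipCM c hc2 (τ Bk).2.1 (oflipCM c hc2 (τ Bk).2.2 Bk.out)) =
            bpot c T₀ (oflipCM c hc2 (τ Bk).2.1 (oflipCM c hc2 (τ Bk).2.2 Bk.out)) → rt c Q' T₀ = rt c (τ Bk).1 T₀))
    (hres : ∀ S : Finset (CMF G c →₀ ℤ), (↑S ⊆ gfaceSet G c hc2) →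
      (∀ Bk : Block c, 2 ≤ bpot c T₀ Bk.out → gface c hc2 Bk.out (τ Bk).2.1 (τ Bk).2.2 ∈ S) →
      (∀ Ψ : CMF G c, 2 ≤ bpot c T₀ Ψ → ∃ Q s s' : G, bpot c T₀ Ψ = ddist (rt c Q T₀) Ψ ∧
        s ∈ (rt c Q T₀).1 \ Ψ.1 ∧ s' ∈ (rt c Q T₀).1 \ Ψ.1 ∧ s ≠ s' ∧
        gface c hc2 Ψ s s' ∈ Submodule.span ℤ (translates c S) ∧
        ((∃ Q₁ t t' : G, bpot c T₀ Ψ = ddist (rt c Q₁ T₀) Ψ ∧ t ∈ (rt c Q₁ T₀).1 \ Ψ.1 ∧ t' ∈ (rt c Q₁ T₀).1 \ Ψ.1 ∧ t ≠ t' ∧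
            (∀ Q' : G, ddist (rt c Q' T₀) (oflipCM c hc2 t Ψ) = bpot c T₀ (oflipCM c hc2 t Ψ) → rt c Q' T₀ = rt c Q₁ T₀) ∧
            (∀ Q' : G, ddist (rt c Q' T₀) (oflipCM c hc2 t' Ψ) = bpot c T₀ (oflipCM c hc2 t' Ψ) → rt c Q' T₀ = rt c Q₁ T₀) ∧
            (∀ Q' : G, ddist (rt c Q' T₀) (oflipCM c hc2 t (oflipCM c hc2 t' Ψ)) = bpot c T₀ (oflipCM c hc2 t (oflipCM c hc2 t' Ψ)) →
              rt c Q' T₀ = rt c Q₁ T₀)) →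
          (∀ Q' : G, ddist (rt c Q' T₀) (oflipCM c hc2 s Ψ) = bpot c T₀ (oflipCM c hc2 s Ψ) → rt c Q' T₀ = rt c Q T₀) ∧
          (∀ Q' : G, ddist (rt c Q' T₀) (oflipCM c hc2 s' Ψ) = bpot c T₀ (oflipCM c hc2 s' Ψ) → rt c Q' T₀ = rt c Q T₀) ∧
          (∀ Q' : G, ddist (rt c Q' T₀) (oflipCM c hc2 s (oflipCM c hc2 s' Ψ)) = bpot c T₀ (oflipCM c hc2 s (oflipCM c hc2 s' Ψ)) →
            rt c Q' T₀ = rt c Q T₀))) →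
      ∀ y ∈ hodgeSpan c hc2, (∀ Ψ ∈ y.support, bpot c T₀ Ψ ≤ 1) →
        ((2 : ℤ) ^ k) • y ∈ Submodule.span ℤ (pairSet c) ⊔ Submodule.span ℤ (translates c S)) :
    IsLeast {n : ℕ | ∃ S : Finset (CMF G c →₀ ℤ), (↑S ⊆ gfaceSet G c hc2) ∧ S.card = n ∧
      hodgeSpan c hc2 ≤ Submodule.span ℤ (pairSet c) ⊔ Submodule.span ℤ (translates c S)} (fibreTwo c hc2) := by
  obtain ⟨S, hS, hmem, -, hli, hlow, hdesc⟩ := exists_chosen_strict_lowering_cover c T₀ hc2 τ hτlow hτstr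
  exact isLeast_card_gfaces_generate_of_residual_closure_par c hG hc2 hc1 hcen S hS hli (fun Ψ => bpot c T₀ Ψ ≤ 1) k
    (fun y => hdesc _ le_sup_right y) (hres S hS hmem hlow)

/-! ## §3 Admissible choices exist (the unconstrained cover of part I is the special case) -/

/-- **An admissible choice exists** with a prescribed lowering triple `τ₀` at ONE far block representative `B₀.out` carrying no strict triple:
lowering everywhere, strict wherever possible, and equal to `τ₀` at `B₀`. [folklore] -/
theorem exists_admissible_choice (hc2 : c * c = 1) (B₀ : Block c) (τ₀ : G × G × G)
    (h₀ : bpot c T₀ B₀.out = ddist (rt c τ₀.1 T₀) B₀.out ∧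
      τ₀.2.1 ∈ (rt c τ₀.1 T₀).1 \ B₀.out.1 ∧ τ₀.2.2 ∈ (rt c τ₀.1 T₀).1 \ B₀.out.1 ∧ τ₀.2.1 ≠ τ₀.2.2)
    (h₀ns : ¬ ∃ Q₁ t t' : G, bpot c T₀ B₀.out = ddist (rt c Q₁ T₀) B₀.out ∧
        t ∈ (rt c Q₁ T₀).1 \ B₀.out.1 ∧ t' ∈ (rt c Q₁ T₀).1 \ B₀.out.1 ∧ t ≠ t' ∧
        (∀ Q' : G, ddist (rt c Q' T₀) (oflipCM c hc2 t B₀.out) = bpot c T₀ (oflipCM c hc2 t B₀.out) → rt c Q' T₀ = rt c Q₁ T₀) ∧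
        (∀ Q' : G, ddist (rt c Q' T₀) (oflipCM c hc2 t' B₀.out) = bpot c T₀ (oflipCM c hc2 t' B₀.out) → rt c Q' T₀ = rt c Q₁ T₀) ∧
        (∀ Q' : G, ddist (rt c Q' T₀) (oflipCM c hc2 t (oflipCM c hc2 t' B₀.out)) = bpot c T₀ (oflipCM c hc2 t (oflipCM c hc2 t' B₀.out)) →
          rt c Q' T₀ = rt c Q₁ T₀)) :
    ∃ τ : Block c → G × G × G, τ B₀ = τ₀ ∧
      (∀ Bk : Block c, 2 ≤ bpot c T₀ Bk.out →
        bpot c T₀ Bk.out = ddist (rt c (τ Bk).1 T₀) Bk.out ∧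
          (τ Bk).2.1 ∈ (rt c (τ Bk).1 T₀).1 \ Bk.out.1 ∧ (τ Bk).2.2 ∈ (rt c (τ Bk).1 T₀).1 \ Bk.out.1 ∧ (τ Bk).2.1 ≠ (τ Bk).2.2) ∧
      (∀ Bk : Block c, (∃ Q₁ t t' : G, bpot c T₀ Bk.out = ddist (rt c Q₁ T₀) Bk.out ∧
          t ∈ (rt c Q₁ T₀).1 \ Bk.out.1 ∧ t' ∈ (rt c Q₁ T₀).1 \ Bk.out.1 ∧ t ≠ t' ∧
          (∀ Q' : G, ddist (rt c Q' T₀) (oflipCM c hc2 t Bk.out) = bpot c T₀ (oflipCM c hc2 t Bk.out) → rt c Q' T₀ = rt c Q₁ T₀) ∧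
          (∀ Q' : G, ddist (rt c Q' T₀) (oflipCM c hc2 t' Bk.out) = bpot c T₀ (oflipCM c hc2 t' Bk.out) → rt c Q' T₀ = rt c Q₁ T₀) ∧
          (∀ Q' : G, ddist (rt c Q' T₀) (oflipCM c hc2 t (oflipCM c hc2 t' Bk.out)) = bpot c T₀ (oflipCM c hc2 t (oflipCM c hc2 t' Bk.out)) →
            rt c Q' T₀ = rt c Q₁ T₀)) →
        bpot c T₀ Bk.out = ddist (rt c (τ Bk).1 T₀) Bk.out ∧
          (τ Bk).2.1 ∈ (rt c (τ Bk).1 T₀).1 \ Bk.out.1 ∧ (τ Bk).2.2 ∈ (rt c (τ Bk).1 T₀).1 \ Bk.out.1 ∧ (τ Bk).2.1 ≠ (τ Bk).2.2 ∧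
          (∀ Q' : G, ddist (rt c Q' T₀) (oflipCM c hc2 (τ Bk).2.1 Bk.out) = bpot c T₀ (oflipCM c hc2 (τ Bk).2.1 Bk.out) →
            rt c Q' T₀ = rt c (τ Bk).1 T₀) ∧
          (∀ Q' : G, ddist (rt c Q' T₀) (oflipCM c hc2 (τ Bk).2.2 Bk.out) = bpot c T₀ (oflipCM c hc2 (τ Bk).2.2 Bk.out) →
            rt c Q' T₀ = rt c (τ Bk).1 T₀) ∧
          (∀ Q' : G, ddist (rt c Q' T₀) (oflipCM c hc2 (τ Bk).2.1 (oflipCM c hc2 (τ Bk).2.2 Bk.out)) =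
              bpot c T₀ (oflipCM c hc2 (τ Bk).2.1 (oflipCM c hc2 (τ Bk).2.2 Bk.out)) → rt c Q' T₀ = rt c (τ Bk).1 T₀)) := by
  classical
  -- at every other block: strict if possible, lowering always (as in part I); at `B₀`: the prescribed triple
  have hch : ∀ Bk : Block c, ∃ σ : G × G × G, (Bk = B₀ → σ = τ₀) ∧ (2 ≤ bpot c T₀ Bk.out →
      bpot c T₀ Bk.out = ddist (rt c σ.1 T₀) Bk.out ∧
        σ.2.1 ∈ (rt c σ.1 T₀).1 \ Bk.out.1 ∧ σ.2.2 ∈ (rt c σ.1 T₀).1 \ Bk.out.1 ∧ σ.2.1 ≠ σ.2.2) ∧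
      ((∃ Q₁ t t' : G, bpot c T₀ Bk.out = ddist (rt c Q₁ T₀) Bk.out ∧
          t ∈ (rt c Q₁ T₀).1 \ Bk.out.1 ∧ t' ∈ (rt c Q₁ T₀).1 \ Bk.out.1 ∧ t ≠ t' ∧
          (∀ Q' : G, ddist (rt c Q' T₀) (oflipCM c hc2 t Bk.out) = bpot c T₀ (oflipCM c hc2 t Bk.out) → rt c Q' T₀ = rt c Q₁ T₀) ∧
          (∀ Q' : G, ddist (rt c Q' T₀) (oflipCM c hc2 t' Bk.out) = bpot c T₀ (oflipCM c hc2 t' Bk.out) → rt c Q' T₀ = rt c Q₁ T₀) ∧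
          (∀ Q' : G, ddist (rt c Q' T₀) (oflipCM c hc2 t (oflipCM c hc2 t' Bk.out)) = bpot c T₀ (oflipCM c hc2 t (oflipCM c hc2 t' Bk.out)) →
            rt c Q' T₀ = rt c Q₁ T₀)) →
        bpot c T₀ Bk.out = ddist (rt c σ.1 T₀) Bk.out ∧
          σ.2.1 ∈ (rt c σ.1 T₀).1 \ Bk.out.1 ∧ σ.2.2 ∈ (rt c σ.1 T₀).1 \ Bk.out.1 ∧ σ.2.1 ≠ σ.2.2 ∧
          (∀ Q' : G, ddist (rt c Q' T₀) (oflipCM c hc2 σ.2.1 Bk.out) = bpot c T₀ (oflipCM c hc2 σ.2.1 Bk.out) → rt c Q' T₀ = rt c σ.1 T₀) ∧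
          (∀ Q' : G, ddist (rt c Q' T₀) (oflipCM c hc2 σ.2.2 Bk.out) = bpot c T₀ (oflipCM c hc2 σ.2.2 Bk.out) → rt c Q' T₀ = rt c σ.1 T₀) ∧
          (∀ Q' : G, ddist (rt c Q' T₀) (oflipCM c hc2 σ.2.1 (oflipCM c hc2 σ.2.2 Bk.out)) =
              bpot c T₀ (oflipCM c hc2 σ.2.1 (oflipCM c hc2 σ.2.2 Bk.out)) → rt c Q' T₀ = rt c σ.1 T₀)) := by
    intro Bk
    by_cases hB : Bk = B₀
    · subst hB
      exact ⟨τ₀, fun _ => rfl, fun _ => h₀, fun hex => absurd hex h₀ns⟩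
    · by_cases hs : ∃ Q₁ t t' : G, bpot c T₀ Bk.out = ddist (rt c Q₁ T₀) Bk.out ∧
          t ∈ (rt c Q₁ T₀).1 \ Bk.out.1 ∧ t' ∈ (rt c Q₁ T₀).1 \ Bk.out.1 ∧ t ≠ t' ∧
          (∀ Q' : G, ddist (rt c Q' T₀) (oflipCM c hc2 t Bk.out) = bpot c T₀ (oflipCM c hc2 t Bk.out) → rt c Q' T₀ = rt c Q₁ T₀) ∧
          (∀ Q' : G, ddist (rt c Q' T₀) (oflipCM c hc2 t' Bk.out) = bpot c T₀ (oflipCM c hc2 t' Bk.out) → rt c Q' T₀ = rt c Q₁ T₀) ∧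
          (∀ Q' : G, ddist (rt c Q' T₀) (oflipCM c hc2 t (oflipCM c hc2 t' Bk.out)) = bpot c T₀ (oflipCM c hc2 t (oflipCM c hc2 t' Bk.out)) →
            rt c Q' T₀ = rt c Q₁ T₀)
      · obtain ⟨Q₁, t, t', h1, ht, ht', htt', hu1, hu2, hu3⟩ := hs
        exact ⟨(Q₁, t, t'), fun h => absurd h hB, fun _ => ⟨h1, ht, ht', htt'⟩, fun _ => ⟨h1, ht, ht', htt', hu1, hu2, hu3⟩⟩
      · by_cases h : 2 ≤ bpot c T₀ Bk.out
        · obtain ⟨Q, t, t', h1, h3, h4, h5⟩ := exists_choice c T₀ Bk.out h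
          exact ⟨(Q, t, t'), fun h' => absurd h' hB, fun _ => ⟨h1, h3, h4, h5⟩, fun h' => absurd h' hs⟩
        · exact ⟨(1, 1, 1), fun h' => absurd h' hB, fun h' => absurd h' h, fun h' => absurd h' hs⟩
  choose τ hτ₀ hτlow hτstr using hch
  exact ⟨τ, hτ₀ B₀ rfl, hτlow, hτstr⟩

end

end Summit.HodgeConjecture.CorCM.Census.CoverClosure
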